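import Literature.MathematicalPhysics.QuantumFieldTheory.Balaban1983to89.B9Eq3105FamThreeTAtMember
import Literature.MathematicalPhysics.QuantumFieldTheory.Balaban1983to89.B9CubeDataHermitianPart
import Literature.MathematicalPhysics.QuantumFieldTheory.Balaban1983to89.B9Cor36GCubeFamFourAtLocCfg
import Literature.MathematicalPhysics.QuantumFieldTheory.Balaban1983to89.B9Cor36GCubeLocAtMemberClosed
import Literature.MathematicalPhysics.QuantumFieldTheory.Balaban1983to89.B9Thm32CinvAtMemberOfCubeDataThmD
import Literature.MathematicalPhysics.QuantumFieldTheory.Balaban1983to89.B9Thm311PosAtRecordV4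
import Literature.MathematicalPhysics.QuantumFieldTheory.Balaban1983to89.B9Eq3105ZetaY

/-!
# `Balaban1983to89.B9Eq3105RestTAtMember` — THE `hV′` SIDE OF THE BOND-SECTOR MEMBER ASSEMBLER: at the unitary matrix fibre, from the TWELVE per-cube
# (3.35) clauses of the target signature (`B8Thm2TorusCoverOfDeltaAAssembler.hThm2Cover_of_prop6_deltaAAssembler`), the TRANSPOSED remainder's majorant
# `hV′ = −(family 4)ᵀ + (family 3)ᵀ + (family 2)ᵀ + (defect)ᵀ ≺ K₀·M_h⁻¹·ℓ(a)·ℓ(a′)⁻¹·e^{−δ₀d}` of M5.7's endpoint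
# `B9Thm310DeltaAIsUnitOfExpansion.eBlock_kernelFamilyBInv_GAY_of_localInverseCubes''`, `δ₀, K₀` MEMBER-INDEPENDENT, at the located letters of the
# HERMITIAN REPRESENTATIVE `Aʰ_□ = ½(A_□ + A_□⋆)` — the twin of `B9Eq3105RestAtMember` (file ASM1-V; seat p33 gen 105)

T. Bałaban, *Propagators for lattice gauge theories in a background field*, Commun. Math. Phys. **99** (1985) 389–434 [`Balaban1985BackgroundPropagators`,
"B9"]: (3.105)–(3.106) p. 414, p. 415 l. 1–37, Thm 3.10 p. 416, p. 398 remark after (3.47) (scale transfer), Cor. 3.6 p. 408, (3.35)–(3.37) p. 396,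
Thm 3.11 p. 416; [4] = [`Balaban1984PropagatorsII`] Lemma 2.1 (2.60)–(2.61) p. 234, Prop. 2.2 (2.65)–(2.67) p. 234.

statement-level skeleton of published theorems with citation tags; proofs where landed; nothing here is a claim about the Yang–Mills mass gap

WHY THIS FILE (cell `lit-balaban`; scope memo `run/shared/lean/pub/lit-balaban/lit-balaban-p33/g105/ASSEMBLER-SCOPE.md`).  M5.7's endpoint displays the
transposed remainder's majorant `hV′` with the length-weighted kernel `θ_V′·ℓ(a)·ℓ(a′)⁻¹·e^{−δ₀d}` of [4] Prop. 2.2.  Its four summands are ∃-threshold packages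
over the twelve cube-data clauses: p38's P3T `famThreeT_at_member` (plain kernel `Θ₃ᵀe^{−κ₃ᵀM_h}e^{−ρ₃ᵀd}` — transferred here to the weighted form by [4]
(2.60) at the rate `ρ₃ᵀ∕2`, `B9Cor36GCubeLocDefectAtLocCfg.scaleTransfer_len_geo9K`, above ONE more threshold `2·log L ≤ ρ₃ᵀ(2L²−1)·L·M_h`), p33's
`sum_conj_famFourT_src_at_locCfg'` and `sum_conj_locDefectTBY_src_at_locCfg'` (weighted kernels), and the transposed family 2, which VANISHES at the ζ of
record (`hasMajorant_sum_famTwoT_zetaY`); the member-level letters are supplied exactly as in `B9Eq3105RestAtMember` (FILE 9, FILE 10-D, Thm 3.11,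
def-Y's unitary transporters, file H).  One rate `δ₀ = min(δ₄, ρ₃ᵀ∕2, δ_E)`, one constant `K₀·M_h⁻¹`.

WHAT THIS FILE PROVES (theorems only; 0 `def`, 0 `def … : Prop`, 0 sorry; standard axioms).
* §0 (private) `exp_neg_mul_le_inv`.
* §1 ★★★ `restT_at_member` — `∃ δ₀ K₀ M₀ T₀ N₀ a₁`, for every member above the thresholds with `c_f = L^k`, every section `ιB`, unitary-valued `U`,
  bi-contractive gauges and data obeying the twelve clauses, every background family through `U`: the endpoint's `hV′` at the located letters of `Aʰ` with
  kernel `K₀·M_h⁻¹·ℓ(a)·ℓ(a′)⁻¹·e^{−δ₀d}`.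

HONEST SCOPE.  Pure bookkeeping over landed theorems; the defect family is an (R)-design term, NOT in print.  NOT here: the `hrest` side (`B9Eq3105RestAtMember`),
the located smallness and (1ₛ) ∧ (Eₛ) (ASM2).  Count-neutral; no summit ∕ node statement proved; nothing continuum ∕ OS ∕ mass gap ∕ Clay; YM mass gap NOT
proved (Track A conditional rung).  `--supports stmt-QuantumFields-19200`.  RELATED, NOT DUPLICATED (searched 2026-08-29: `lean search 'restT_at_member' --decl` ∅).
-/

noncomputable section

open scoped BigOperators Matrix Matrix.Norms.L2Operator

namespace Literature.MathematicalPhysics.QuantumFieldTheory.Balaban1983to89.B9Eq3105RestTAtMember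

open NormedSpace Complex
open B6RandomWalk (HasMajorant hasMajorant_mono hasMajorant_add)
open B9Thm34Ext (toB6)
open B9FromB6 (EBlock)
open B9Ineq347 (ScaleTransfer)
open B9Eq352DivFormLetters (conj)
open B6KLevelCensusIndexV1 (KIdx kGeo)
open B6Cover236MultiLevelBlocks (cubes)
open B6GlobalChartV1 (PV boxEquiv blkV1)
open B6Ineq2142KLevelV1 (β)
open B9GeoNormsKLevelV1 (geo9K)
open B9BackgroundsKLevelV1 (shiftsV1)
open B9Eq39Adjoint (fluct covD)
open B9Eq360DeltaPrimeAY (AfldY)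
open B9CubeGeometryInputs (RM1)
open B9CubeLettersInvReadings (kernelFamilySInv kernelFamilyBInv)
open B9Thm37CubeCoverCommutators (cutMulY hTY)
open B4PartitionUnity22 (thetaProf D1)
open B9Cor36CubeCutoffs (SC NearC chiY locCfgY one_le_SC)
open B9Eq3104CutoffCommutators (hBdY DPDsY deltaLocY)
open B9Eq3105ZetaY (zetaY abs_zetaY_le_one)
open B9Cor36GCubeLocLetter (locLetterBY locProjBY locP1BY locDefectBY locDefectTBY)
open B9Cor36GCubeFamFourAtLocCfg (sum_conj_famFourT_src_at_locCfg')
open B9Cor36GCubeLocDefectAtLocCfg (sum_conj_locDefectTBY_src_at_locCfg' scaleTransfer_len_geo9K)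
open B9Cor36GCubeLocAtMemberClosed (eBlock_locLetterBY'')
open B9Thm32CinvAtMemberOfCubeDataThmD (cinv_at_member_of_cubeData_thmD)
open B9Eq3105FamThreeTAtMember (famThreeT_at_member)
open B9Ineq349DPDsYOfEBlock (hasMajorant_sum_famTwoT_zetaY)
open B9CubeDataHermitianPart (hermitianPart_cubeData mem_unitaryUnits_of_bicontractive)
open B7Prop2Explicit (unitaryUnits mem_unitaryUnits unitaryUnits_le_U1)
open B7Prop1Explicit (mem_U1)
open Node00 (SiteY BlkY IBondY FBondY CfgY GaugeY SiteOpY BondOpY SiteParY BondParY toKT UboxY GpY deltaPrimeAY gaugeY gaugeY_apply parSymY parBY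
  parSymY_mem parBY_mem etaS XY XinvY qT)

variable {d ℓ : ℕ} {hd : 1 ≤ d + 1} {hL : Odd (ℓ + 1) ∧ 1 < ℓ + 1} {b₀ b₁ : ℝ}
variable {ι : Type} [Fintype ι]

/-! ## §0 Bookkeeping -/

/-- `e^{−κM} ≤ κ⁻¹M⁻¹` for `κ, M > 0` (`x + 1 ≤ eˣ`). [folklore] -/
private theorem exp_neg_mul_le_inv {κ M : ℝ} (hκ : 0 < κ) (hM : 0 < M) : Real.exp (-(κ * M)) ≤ κ⁻¹ * M⁻¹ := by
  have h1 : κ * M + 1 ≤ Real.exp (κ * M) := Real.add_one_le_exp _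
  have h2 : 0 < κ * M := mul_pos hκ hM
  rw [Real.exp_neg, ← mul_inv]
  exact inv_anti₀ h2 (by linarith)

/-! ## §1 ★★★ The `hV′` side of the member assembler -/

set_option maxHeartbeats 4000000 in
/-- ★★★ **THE `hV′` SIDE OF THE BOND-SECTOR MEMBER ASSEMBLER** (the transposes `h_□G_□h_□ζ_□̃(DPD* − DP_□D*)`, `h_□G_□h_□(1 − ζ_□̃)DPD*`, `h_□G_□P_{□,1}`
of the (3.105) families p. 414 — the (R)-design's bookkeeping of [4] Prop. 2.2's transposed inputs, not displayed in print — + the transposed defect family;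
[4] Prop. 2.2's length-weighted kernel): at the unitary matrix fibre, from the twelve (3.35)
cube-data clauses, the endpoint's `hV′` at the located letters of the hermitian representative `Aʰ`, `≺ K₀·M_h⁻¹·ℓ(a)·ℓ(a′)⁻¹·e^{−δ₀d}` with `δ₀, K₀`
member-independent.  DEFECT LABEL: the defect family is an (R)-design term, NOT in print.
[cite: Balaban1985BackgroundPropagators, (3.105)–(3.106) p.414, p.415 l.1–37, Thm 3.10 p.416, p.398 remark after (3.47), Cor. 3.6 p.408, (3.35)–(3.37) p.396; Balaban1984PropagatorsII, Lemma 2.1 (2.60)–(2.61) p.234, Prop. 2.2 (2.65)–(2.67) p.234] -/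
theorem restT_at_member {N : ℕ} [NeZero N] [DecidableEq ι]
    [∀ i' : KIdx d ℓ hd hL b₀ b₁, Fintype (geo9K i').Site] [∀ i' : KIdx d ℓ hd hL b₀ b₁, DecidableEq (geo9K i').Site]
    (Rr : KIdx d ℓ hd hL b₀ b₁ → ℝ) (Hp : KIdx d ℓ hd hL b₀ b₁ → Prop) (b : Module.Basis ι ℝ (Matrix (Fin N) (Fin N) ℂ)) (hℓ : 1 ≤ ℓ)
    (hb₀ : 0 < b₀) (hb₁ : b₀ ≤ b₁) {M₂ : ℝ} (hM₂ : 0 ≤ M₂) (hrepr : ∀ (v : (Matrix (Fin N) (Fin N) ℂ)) (j : ι), |b.repr v j| ≤ M₂ * ‖v‖) :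
    ∃ δ₀ K₀ M₀ T₀ : ℝ, ∃ N₀ : ℕ, 0 < δ₀ ∧ 0 ≤ K₀ ∧ ∃ a₁ : ℝ, 0 < a₁ ∧
    ∀ (i : KIdx d ℓ hd hL b₀ b₁),
      M₀ ≤ ((ℓ : ℝ) + 1) * (toKT i).Mh → N₀ + 1 ≤ (toKT i).R * ((ℓ + 1) * (toKT i).Mh) → T₀ ≤ RM1 i → i.cf = (((ℓ + 1 : ℕ) : ℝ)) ^ i.k →
    ∀ (ιB : BlkY i → IBondY i), (∀ s, β i.hN i.D i.hk (ιB s) = s) →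
    ∀ (U : CfgY (Matrix (Fin N) (Fin N) ℂ) i), (∀ μ x, U μ x ∈ unitaryUnits (Matrix (Fin N) (Fin N) ℂ)) →
    ∀ (g : ↥(cubes (toKT i).D.toDomains) → GaugeY (Matrix (Fin N) (Fin N) ℂ) i),
      (∀ c x, ‖(g c x : (Matrix (Fin N) (Fin N) ℂ))‖ ≤ 1 ∧ ‖(((g c x)⁻¹ : (Matrix (Fin N) (Fin N) ℂ)ˣ) : (Matrix (Fin N) (Fin N) ℂ))‖ ≤ 1) →
    ∀ (A : ↥(cubes (toKT i).D.toDomains) → AfldY (Matrix (Fin N) (Fin N) ℂ) i)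
      (Q : ↥(cubes (toKT i).D.toDomains) → Set (Site (PV d ℓ i.m i.K hd hL) 0)) (C ξ Λ : ↥(cubes (toKT i).D.toDomains) → ℝ),
      (∀ c, 0 ≤ C c) → (∀ c, 0 < ξ c) → (∀ c, 1 ≤ Λ c) → (∀ c, ξ c ≤ 5 * (SC i c : ℝ) * (kGeo i).eta) →
      (∀ c, LatticeNorms.scaleLen ((ℓ : ℝ) + 1) (kGeo i).eta (c.1.1 + 1) ≤ Λ c * ξ c) →
      (∀ c, ∀ x : Site (PV d ℓ i.m i.K hd hL) 0, NearC i c (35 * SC i c / 8 + 1) (boxEquiv i.hN x).1 → x ∈ Q c) →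
      (∀ c, ∀ (κ : Fin (d + 1)) (x : Site (PV d ℓ i.m i.K hd hL) 0), x ∈ Q c → x.shift κ ∈ Q c →
        gaugeY i (g c) U κ x = fluct (kGeo i).eta (A c) κ x) →
      (∀ c, ∀ κ, ∀ x ∈ Q c, ‖A c κ x‖ ≤ C c * (ξ c)⁻¹) →
      (∀ c, ∀ μ ν, ∀ x ∈ Q c,
        ‖(((kGeo i).eta : ℂ)⁻¹) • covD (shiftsV1 (PV d ℓ i.m i.K hd hL)) (fun _ _ => (1 : (Matrix (Fin N) (Fin N) ℂ)ˣ)) μ (A c ν) x‖ ≤ C c * (ξ c ^ 2)⁻¹) →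
      (∀ c, max (C c) (C c * (1 + D1 thetaProf)) * Λ c ^ 2 ≤ a₁) → (∀ c, max (C c) (C c * (1 + D1 thetaProf)) * Λ c ^ 2 ≤ 1 / 4) →
    ∀ {B : B9.Backgrounds} (cfg : B.Cfg → CfgY (Matrix (Fin N) (Fin N) ℂ) i) (par : BondParY (Matrix (Fin N) (Fin N) ℂ) i) (U₁ : B.Cfg), cfg U₁ = U →
      HasMajorant (g := toB6 (geo9K i) (Rr i) (Hp i)) (fun p : FBondY i × ι => ιB (blkV1 i.hN i.D p.1))
        (-(∑ c : ↥(cubes i.D.toDomains), conj b ((cutMulY (𝔸 := (Matrix (Fin N) (Fin N) ℂ)) (hBdY i (hTY i c)) * locLetterBY i c (parSymY i) (parBY i) (g c) (chiY i c) (locCfgY i c (kGeo i).eta (fun κ x => (2 : ℂ)⁻¹ • (A c κ x + star (A c κ x)))) * locP1BY i c (parSymY i) (g c) (hTY i c) (locCfgY i c (kGeo i).eta (fun κ x => (2 : ℂ)⁻¹ • (A c κ x + star (A c κ x))))).restrictScalars ℝ))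
          + ∑ c : ↥(cubes i.D.toDomains), conj b ((cutMulY (𝔸 := (Matrix (Fin N) (Fin N) ℂ)) (hBdY i (hTY i c)) * locLetterBY i c (parSymY i) (parBY i) (g c) (chiY i c) (locCfgY i c (kGeo i).eta (fun κ x => (2 : ℂ)⁻¹ • (A c κ x + star (A c κ x)))) * cutMulY (𝔸 := (Matrix (Fin N) (Fin N) ℂ)) (hBdY i (hTY i c)) *
              (cutMulY (𝔸 := (Matrix (Fin N) (Fin N) ℂ)) (hBdY i (zetaY i c)) * (DPDsY i (parSymY i) (GpY i (parSymY i)) (cfg U₁) - locProjBY i c (parSymY i) (g c) (locCfgY i c (kGeo i).eta (fun κ x => (2 : ℂ)⁻¹ • (A c κ x + star (A c κ x))))))).restrictScalars ℝ)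
          + ∑ c : ↥(cubes i.D.toDomains), conj b ((cutMulY (𝔸 := (Matrix (Fin N) (Fin N) ℂ)) (hBdY i (hTY i c)) * locLetterBY i c (parSymY i) (parBY i) (g c) (chiY i c) (locCfgY i c (kGeo i).eta (fun κ x => (2 : ℂ)⁻¹ • (A c κ x + star (A c κ x)))) * cutMulY (𝔸 := (Matrix (Fin N) (Fin N) ℂ)) (hBdY i (hTY i c)) *
              ((1 - cutMulY (𝔸 := (Matrix (Fin N) (Fin N) ℂ)) (hBdY i (zetaY i c))) * DPDsY i (parSymY i) (GpY i (parSymY i)) (cfg U₁))).restrictScalars ℝ)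
          + ∑ c : ↥(cubes i.D.toDomains), conj b ((locDefectTBY i c (parSymY i) (parBY i) (g c) (chiY i c) (hTY i c) (locCfgY i c (kGeo i).eta (fun κ x => (2 : ℂ)⁻¹ • (A c κ x + star (A c κ x))))).restrictScalars ℝ))
        (fun a a' => K₀ * (((toKT i).Mh : ℝ))⁻¹ * (geo9K i).len a * ((geo9K i).len a')⁻¹ * Real.exp (-(δ₀ * (geo9K i).dist a a'))) := by
  classical
  letI : CStarAlgebra (Matrix (Fin N) (Fin N) ℂ) := {}
  have hL1 : (1 : ℝ) ≤ (ℓ : ℝ) + 1 := by linarith [(Nat.cast_nonneg ℓ : (0 : ℝ) ≤ ℓ)]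
  have hlog : 0 ≤ Real.log ((ℓ : ℝ) + 1) := Real.log_nonneg hL1
  have h2L : (0 : ℝ) < 2 * ((ℓ : ℝ) + 1) ^ 2 - 1 := by nlinarith only [hL1]
  -- ═══ the member-independent packages ═══
  obtain ⟨δG, KG, M₀G, T₀G, N₀G, hδG, hKG, a₁G, ha₁G, HG⟩ :=
    B9Cor36GpCoverBindersUnitary.eBlock_GpY_of_cubeData_unitary b (le_refl (unitaryUnits (Matrix (Fin N) (Fin N) ℂ))) Rr Hp hℓ hM₂ hrepr
  obtain ⟨δX, KX, M₀X, T₀X, N₀X, hδX, hKX, a₁X, ha₁X, HX⟩ :=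
    cinv_at_member_of_cubeData_thmD b (le_refl (unitaryUnits (Matrix (Fin N) (Fin N) ℂ))) Rr Hp hℓ hM₂ hrepr
  obtain ⟨δO, BO, M₀O, T₀O, N₀O, hδO, hBO, a₁O, ha₁O, HO⟩ := eBlock_locLetterBY'' b hℓ hb₀ hb₁ M₂ hM₂ hrepr
  obtain ⟨ρ₃, κ₃, Θ₃, M₀₃, T₀₃, N₀₃, hρ₃, hκ₃, hΘ₃, a₁₃, ha₁₃, H3⟩ := famThreeT_at_member Rr Hp b hℓ hM₂ hrepr hδG hδX hδO hKG hKX hBO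
  obtain ⟨δ₄, Θ₄, M₀₄, T₀₄, N₀₄, hδ₄, hΘ₄, a₁₄, ha₁₄, H4⟩ := sum_conj_famFourT_src_at_locCfg' b hℓ hb₀ hb₁ M₂ hM₂ hrepr
  obtain ⟨δE, ΘE, M₀E, T₀E, N₀E, hδE, hΘE, a₁E, ha₁E, HE⟩ := sum_conj_locDefectTBY_src_at_locCfg' b hℓ hb₀ hb₁ M₂ hM₂ hrepr
  -- ═══ the common rate and constant ═══
  obtain ⟨δ₀, hδ₀def⟩ : ∃ x : ℝ, x = min δ₄ (min (ρ₃ / 2) δE) := ⟨_, rfl⟩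
  have hδ₀ : 0 < δ₀ := by rw [hδ₀def]; exact lt_min hδ₄ (lt_min (half_pos hρ₃) hδE)
  have hδ₀4 : δ₀ ≤ δ₄ := by rw [hδ₀def]; exact min_le_left _ _
  have hδ₀3 : δ₀ ≤ ρ₃ / 2 := by rw [hδ₀def]; exact (min_le_right _ _).trans (min_le_left _ _)
  have hδ₀E : δ₀ ≤ δE := by rw [hδ₀def]; exact (min_le_right _ _).trans (min_le_right _ _)
  obtain ⟨K₀, hK₀def⟩ : ∃ x : ℝ, x = Θ₄ + Θ₃ * ((ℓ : ℝ) + 1) * κ₃⁻¹ + ΘE * δE⁻¹ := ⟨_, rfl⟩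
  have hK₀ : 0 ≤ K₀ := by rw [hK₀def]; positivity
  refine ⟨δ₀, K₀, max (max (max (M₀G) (M₀X)) (max (M₀O) (M₀₃))) (max (max (M₀₄) (M₀E)) (max ((2 * ((ℓ : ℝ) + 1) ^ 2)) ((2 * Real.log ((ℓ : ℝ) + 1) / (ρ₃ * (2 * ((ℓ : ℝ) + 1) ^ 2 - 1)))))), max (max (T₀G) (max (T₀X) (T₀O))) (max (T₀₃) (max (T₀₄) (T₀E))), max (max (N₀G) (max (N₀X) (N₀O))) (max (N₀₃) (max (N₀₄) (N₀E))), hδ₀, hK₀, min (min (a₁G) (min (a₁X) (a₁O))) (min (a₁₃) (min (a₁₄) (a₁E))),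
    lt_min (lt_min ha₁G (lt_min ha₁X ha₁O)) (lt_min ha₁₃ (lt_min ha₁₄ ha₁E)), ?_⟩
  intro i hM hN hT hcf ιB hι U hUu g hg A Q C ξ Λ hC0 hξ hΛ hξS hΛξ hQ hgA hAb hdA hs₁ hs₄ B cfg par U₁ hcfg
  subst hcfg
  -- ─── thresholds ───
  have hMG : M₀G ≤ ((ℓ : ℝ) + 1) * (toKT i).Mh := le_trans ((((le_max_left _ _)).trans (le_max_left _ _)).trans (le_max_left _ _)) hM
  have hMX : M₀X ≤ ((ℓ : ℝ) + 1) * (toKT i).Mh := le_trans ((((le_max_right _ _)).trans (le_max_left _ _)).trans (le_max_left _ _)) hM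
  have hMO : M₀O ≤ ((ℓ : ℝ) + 1) * (toKT i).Mh := le_trans ((((le_max_left _ _)).trans (le_max_right _ _)).trans (le_max_left _ _)) hM
  have hM3 : M₀₃ ≤ ((ℓ : ℝ) + 1) * (toKT i).Mh := le_trans ((((le_max_right _ _)).trans (le_max_right _ _)).trans (le_max_left _ _)) hM
  have hM4 : M₀₄ ≤ ((ℓ : ℝ) + 1) * (toKT i).Mh := le_trans ((((le_max_left _ _)).trans (le_max_left _ _)).trans (le_max_right _ _)) hM
  have hME : M₀E ≤ ((ℓ : ℝ) + 1) * (toKT i).Mh := le_trans ((((le_max_right _ _)).trans (le_max_left _ _)).trans (le_max_right _ _)) hM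
  have hMtr : (2 * Real.log ((ℓ : ℝ) + 1) / (ρ₃ * (2 * ((ℓ : ℝ) + 1) ^ 2 - 1))) ≤ ((ℓ : ℝ) + 1) * (toKT i).Mh := le_trans ((((le_max_right _ _)).trans (le_max_right _ _)).trans (le_max_right _ _)) hM
  have hTG : T₀G ≤ RM1 i := le_trans (((le_max_left _ _)).trans (le_max_left _ _)) hT
  have hTX : T₀X ≤ RM1 i := le_trans ((((le_max_left _ _)).trans (le_max_right _ _)).trans (le_max_left _ _)) hT
  have hTO : T₀O ≤ RM1 i := le_trans ((((le_max_right _ _)).trans (le_max_right _ _)).trans (le_max_left _ _)) hT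
  have hT3 : T₀₃ ≤ RM1 i := le_trans (((le_max_left _ _)).trans (le_max_right _ _)) hT
  have hT4 : T₀₄ ≤ RM1 i := le_trans ((((le_max_left _ _)).trans (le_max_right _ _)).trans (le_max_right _ _)) hT
  have hTE : T₀E ≤ RM1 i := le_trans ((((le_max_right _ _)).trans (le_max_right _ _)).trans (le_max_right _ _)) hT
  have hNG : N₀G + 1 ≤ (toKT i).R * ((ℓ + 1) * (toKT i).Mh) := le_trans (Nat.succ_le_succ (((le_max_left _ _)).trans (le_max_left _ _))) hN
  have hNX : N₀X + 1 ≤ (toKT i).R * ((ℓ + 1) * (toKT i).Mh) := le_trans (Nat.succ_le_succ ((((le_max_left _ _)).trans (le_max_right _ _)).trans (le_max_left _ _))) hN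
  have hNO : N₀O + 1 ≤ (toKT i).R * ((ℓ + 1) * (toKT i).Mh) := le_trans (Nat.succ_le_succ ((((le_max_right _ _)).trans (le_max_right _ _)).trans (le_max_left _ _))) hN
  have hN3 : N₀₃ + 1 ≤ (toKT i).R * ((ℓ + 1) * (toKT i).Mh) := le_trans (Nat.succ_le_succ (((le_max_left _ _)).trans (le_max_right _ _))) hN
  have hN4 : N₀₄ + 1 ≤ (toKT i).R * ((ℓ + 1) * (toKT i).Mh) := le_trans (Nat.succ_le_succ ((((le_max_left _ _)).trans (le_max_right _ _)).trans (le_max_right _ _))) hN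
  have hNE : N₀E + 1 ≤ (toKT i).R * ((ℓ + 1) * (toKT i).Mh) := le_trans (Nat.succ_le_succ ((((le_max_right _ _)).trans (le_max_right _ _)).trans (le_max_right _ _))) hN
  have haG : ∀ c, max (C c) (C c * (1 + D1 thetaProf)) * Λ c ^ 2 ≤ a₁G := fun c => (hs₁ c).trans ((min_le_left _ _).trans ((min_le_left _ _)))
  have haX : ∀ c, max (C c) (C c * (1 + D1 thetaProf)) * Λ c ^ 2 ≤ a₁X := fun c => (hs₁ c).trans ((min_le_left _ _).trans ((min_le_right _ _).trans ((min_le_left _ _))))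
  have haO : ∀ c, max (C c) (C c * (1 + D1 thetaProf)) * Λ c ^ 2 ≤ a₁O := fun c => (hs₁ c).trans ((min_le_left _ _).trans ((min_le_right _ _).trans ((min_le_right _ _))))
  have ha3 : ∀ c, max (C c) (C c * (1 + D1 thetaProf)) * Λ c ^ 2 ≤ a₁₃ := fun c => (hs₁ c).trans ((min_le_right _ _).trans ((min_le_left _ _)))
  have ha4 : ∀ c, max (C c) (C c * (1 + D1 thetaProf)) * Λ c ^ 2 ≤ a₁₄ := fun c => (hs₁ c).trans ((min_le_right _ _).trans ((min_le_right _ _).trans ((min_le_left _ _))))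
  have haE : ∀ c, max (C c) (C c * (1 + D1 thetaProf)) * Λ c ^ 2 ≤ a₁E := fun c => (hs₁ c).trans ((min_le_right _ _).trans ((min_le_right _ _).trans ((min_le_right _ _))))
  have hMhEq : ((toKT i).Mh : ℝ) = (i.Mh : ℝ) := rfl
  have hMh8 : (8 : ℝ) ≤ (i.Mh : ℝ) := by exact_mod_cast i.hM8
  have hMh0 : (0 : ℝ) < (i.Mh : ℝ) := by linarith only [hMh8]
  have hMg : (geo9K i).M = ((ℓ : ℝ) + 1) * ((toKT i).Mh : ℝ) := by
    show (((ℓ + 1 : ℕ) : ℝ)) * (i.Mh : ℝ) = ((ℓ : ℝ) + 1) * ((i.Mh : ℕ) : ℝ); push_cast; ring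
  -- the scale transfer of the member lengths at the rate `ρ₃∕2` ([4] (2.60)), above the transfer threshold
  have hST : ScaleTransfer (geo9K i) ρ₃ (1 / 2) ((ℓ : ℝ) + 1) (fun a => (geo9K i).len a) := by
    refine scaleTransfer_len_geo9K i (by positivity) ?_
    have h1 : 2 * Real.log ((ℓ : ℝ) + 1) / (ρ₃ * (2 * ((ℓ : ℝ) + 1) ^ 2 - 1)) ≤ (geo9K i).M := by rw [hMg]; exact hMtr
    rw [div_le_iff₀ (mul_pos hρ₃ h2L)] at h1
    have hM0 : 0 ≤ (geo9K i).M := by rw [hMg]; positivity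
    nlinarith only [h1, hM0, hlog]
  -- ─── the hermitian representative (H) ───
  obtain ⟨hAh, hgAh, hAbh, hdAh, hAuh, hVh⟩ := hermitianPart_cubeData hℓ i (cfg U₁) hUu g hg A Q C ξ Λ hC0 hξ hΛ hΛξ hgA hAb hdA hs₄
  -- ─── the member-level letters at the unitary fibre ───
  have hEG := (HG i hMG hNG hTG hcf ιB hι (cfg U₁) hUu g hg (fun c κ x => (2 : ℂ)⁻¹ • (A c κ x + star (A c κ x))) Q C ξ Λ
    hC0 hξ hΛ hξS hΛξ hQ hgAh hAbh hdAh haG hs₄ cfg U₁ rfl).1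
  have hCinv := HX i hMX hNX hTX hcf ιB hι (cfg U₁) hUu g hg (fun c κ x => (2 : ℂ)⁻¹ • (A c κ x + star (A c κ x))) Q C ξ Λ
    hC0 hξ hΛ hξS hΛξ hQ hgAh hAbh hdAh haX hs₄ cfg U₁ rfl
  have hXu : IsUnit (XY i (parSymY i) (GpY i (parSymY i)) (cfg U₁)) :=
    B9Thm311PosAtRecordV4.isUnit_XY_parSymY i (le_refl (unitaryUnits (Matrix (Fin N) (Fin N) ℂ))) hUu
  have hUΔ : IsUnit (deltaPrimeAY i (parSymY i) (cfg U₁)) :=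
    B9Thm311DeltaPrimePos.isUnit_deltaPrimeAY_parSymY i (le_refl (unitaryUnits (Matrix (Fin N) (Fin N) ℂ))) hUu
  have hpar : ∀ z w : SiteY i, ‖(parSymY i (cfg U₁) z w : (Matrix (Fin N) (Fin N) ℂ))‖ ≤ 1 ∧ ‖(((parSymY i (cfg U₁) z w)⁻¹ : (Matrix (Fin N) (Fin N) ℂ)ˣ) : (Matrix (Fin N) (Fin N) ℂ))‖ ≤ 1 :=
    fun z w => mem_U1.1 (unitaryUnits_le_U1 (parSymY_mem i hUu z w))
  have hgu : ∀ c x, g c x ∈ unitaryUnits (Matrix (Fin N) (Fin N) ℂ) := fun c x => mem_unitaryUnits_of_bicontractive (g c x) (hg c x).1 (hg c x).2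
  have hV'u : ∀ (c : ↥(cubes (toKT i).D.toDomains)) (μ : Fin (d + 1)) (x : Site (PV d ℓ i.m i.K hd hL) 0),
      gaugeY i (g c)⁻¹ (locCfgY i c (kGeo i).eta (fun κ x => (2 : ℂ)⁻¹ • (A c κ x + star (A c κ x)))) μ x ∈ unitaryUnits (Matrix (Fin N) (Fin N) ℂ) := by
    intro c μ x
    rw [gaugeY_apply, Pi.inv_apply, Pi.inv_apply, inv_inv]
    exact Subgroup.mul_mem _ (Subgroup.mul_mem _ (Subgroup.inv_mem _ (hgu c x)) (hVh c μ x)) (hgu c _)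
  have hparV : ∀ (c : ↥(cubes i.D.toDomains)) (z w : SiteY i),
      ‖(parSymY i (gaugeY i (g c)⁻¹ (locCfgY i c (kGeo i).eta (fun κ x => (2 : ℂ)⁻¹ • (A c κ x + star (A c κ x))))) z w : (Matrix (Fin N) (Fin N) ℂ))‖ ≤ 1 ∧
        ‖(((parSymY i (gaugeY i (g c)⁻¹ (locCfgY i c (kGeo i).eta (fun κ x => (2 : ℂ)⁻¹ • (A c κ x + star (A c κ x))))) z w)⁻¹ : (Matrix (Fin N) (Fin N) ℂ)ˣ) : (Matrix (Fin N) (Fin N) ℂ))‖ ≤ 1 :=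
    fun c z w => mem_U1.1 (unitaryUnits_le_U1 (parSymY_mem i (hV'u c) z w))
  -- ─── the cube letters' blocks (p38 `eBlock_locLetterBY''`) ───
  have HOc := fun c : ↥(cubes (toKT i).D.toDomains) => HO i c hMO hNO hTO (g c) (cfg U₁) (fun κ x => (2 : ℂ)⁻¹ • (A c κ x + star (A c κ x))) (Q c) (C c) (ξ c) (Λ c)
    (hC0 c) (hξ c) (hΛ c) (hξS c) (hΛξ c) (hQ c) (hgAh c) (hAbh c) (hdAh c) (hAuh c) (haO c) (hg c) ιB hι (Rr i) (Hp i) cfg par U₁ rfl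
  have hEO : ∀ c : ↥(cubes i.D.toDomains), EBlock (kernelFamilyBInv i B cfg (fun _ => locLetterBY i c (parSymY i) (parBY i) (g c) (chiY i c) (locCfgY i c (kGeo i).eta (fun κ x => (2 : ℂ)⁻¹ • (A c κ x + star (A c κ x))))) par) BO δO U₁ := fun c => (HOc c).2
  -- ─── the four transposed families ───
  have h4 := H4 i hM4 hN4 hT4 g (fun c κ x => (2 : ℂ)⁻¹ • (A c κ x + star (A c κ x))) Q C ξ Λ hC0 hξ hΛ hξS hΛξ hQ hAbh hdAh hAuh ha4 hg
    (fun c => zetaY i c) (fun c z => abs_zetaY_le_one i c z) ιB hι (Rr i) (Hp i)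
  have h4n : HasMajorant (g := toB6 (geo9K i) (Rr i) (Hp i)) (fun p : FBondY i × ι => ιB (blkV1 i.hN i.D p.1))
      (-(∑ c : ↥(cubes i.D.toDomains), conj b ((cutMulY (𝔸 := (Matrix (Fin N) (Fin N) ℂ)) (hBdY i (hTY i c)) * locLetterBY i c (parSymY i) (parBY i) (g c) (chiY i c) (locCfgY i c (kGeo i).eta (fun κ x => (2 : ℂ)⁻¹ • (A c κ x + star (A c κ x)))) * locP1BY i c (parSymY i) (g c) (hTY i c) (locCfgY i c (kGeo i).eta (fun κ x => (2 : ℂ)⁻¹ • (A c κ x + star (A c κ x))))).restrictScalars ℝ)))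
      (fun a a' => Θ₄ * (((ℓ : ℝ) + 1) * ((toKT i).Mh : ℝ))⁻¹ * (geo9K i).len a * ((geo9K i).len a')⁻¹ * Real.exp (-(δ₄ * (geo9K i).dist a a'))) := by
    intro y' μ B' hμ p
    rw [LinearMap.neg_apply, Pi.neg_apply, abs_neg]
    exact h4 y' μ B' hμ p
  have h3 := H3 i hM3 hN3 hT3 hcf (cfg U₁) g hg (fun c κ x => (2 : ℂ)⁻¹ • (A c κ x + star (A c κ x))) Q C ξ Λ hC0 hξ hΛ hξS hΛξ hQ hgAh hAbh hdAh
    ha3 hs₄ cfg par U₁ rfl hEG (fun c => fun _ => locLetterBY i c (parSymY i) (parBY i) (g c) (chiY i c) (locCfgY i c (kGeo i).eta (fun κ x => (2 : ℂ)⁻¹ • (A c κ x + star (A c κ x))))) hEO ιB hι hpar hCinv hUΔ hXu hparV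
  -- transfer the plain family-3 kernel to the length-weighted one
  have h3w : HasMajorant (g := toB6 (geo9K i) (Rr i) (Hp i)) (fun p : FBondY i × ι => ιB (blkV1 i.hN i.D p.1))
      (∑ c : ↥(cubes i.D.toDomains), conj b ((cutMulY (𝔸 := (Matrix (Fin N) (Fin N) ℂ)) (hBdY i (hTY i c)) * locLetterBY i c (parSymY i) (parBY i) (g c) (chiY i c) (locCfgY i c (kGeo i).eta (fun κ x => (2 : ℂ)⁻¹ • (A c κ x + star (A c κ x)))) * cutMulY (𝔸 := (Matrix (Fin N) (Fin N) ℂ)) (hBdY i (hTY i c)) *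
          (cutMulY (𝔸 := (Matrix (Fin N) (Fin N) ℂ)) (hBdY i (zetaY i c)) * (DPDsY i (parSymY i) (fun W => GpY i (parSymY i) W) (cfg U₁) - locProjBY i c (parSymY i) (g c) (locCfgY i c (kGeo i).eta (fun κ x => (2 : ℂ)⁻¹ • (A c κ x + star (A c κ x))))))).restrictScalars ℝ))
      (fun a a' => Θ₃ * ((ℓ : ℝ) + 1) * Real.exp (-(κ₃ * ((toKT i).Mh : ℝ))) * (geo9K i).len a * ((geo9K i).len a')⁻¹ *
        Real.exp (-(ρ₃ / 2 * (geo9K i).dist a a'))) := by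
    refine hasMajorant_mono _ h3 fun a a' => ?_
    have ht := hST a a'
    have hla' : 0 < (geo9K i).len a' := B9GeoLemma21KLevelV1.geo9K_len_pos i a'
    have hsplit : Real.exp (-(ρ₃ * (geo9K i).dist a a')) =
        Real.exp (-(ρ₃ / 2 * (geo9K i).dist a a')) * Real.exp (-(1 / 2 * ρ₃ * (geo9K i).dist a a')) := by
      rw [← Real.exp_add]; congr 1; ring
    have hq : Real.exp (-(1 / 2 * ρ₃ * (geo9K i).dist a a')) ≤ ((ℓ : ℝ) + 1) * (geo9K i).len a * ((geo9K i).len a')⁻¹ := by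
      rw [le_mul_inv_iff₀ hla']; simpa using ht
    calc Θ₃ * Real.exp (-(κ₃ * ((toKT i).Mh : ℝ))) * Real.exp (-(ρ₃ * (geo9K i).dist a a'))
        = Θ₃ * Real.exp (-(κ₃ * ((toKT i).Mh : ℝ))) * Real.exp (-(ρ₃ / 2 * (geo9K i).dist a a')) *
            Real.exp (-(1 / 2 * ρ₃ * (geo9K i).dist a a')) := by rw [hsplit]; ring
      _ ≤ Θ₃ * Real.exp (-(κ₃ * ((toKT i).Mh : ℝ))) * Real.exp (-(ρ₃ / 2 * (geo9K i).dist a a')) *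
            (((ℓ : ℝ) + 1) * (geo9K i).len a * ((geo9K i).len a')⁻¹) := mul_le_mul_of_nonneg_left hq (by positivity)
      _ = Θ₃ * ((ℓ : ℝ) + 1) * Real.exp (-(κ₃ * ((toKT i).Mh : ℝ))) * (geo9K i).len a * ((geo9K i).len a')⁻¹ *
            Real.exp (-(ρ₃ / 2 * (geo9K i).dist a a')) := by ring
  have h2 := hasMajorant_sum_famTwoT_zetaY i b (Rr i) (Hp i) ιB (fun c => fun _ => locLetterBY i c (parSymY i) (parBY i) (g c) (chiY i c) (locCfgY i c (kGeo i).eta (fun κ x => (2 : ℂ)⁻¹ • (A c κ x + star (A c κ x)))))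
    (DPDsY i (parSymY i) (GpY i (parSymY i)) (cfg U₁)) (cfg U₁) (K := fun _ _ => (0 : ℝ)) (fun _ _ => le_rfl)
  have hD := HE i hME hNE hTE g (fun c κ x => (2 : ℂ)⁻¹ • (A c κ x + star (A c κ x))) Q C ξ Λ hC0 hξ hΛ hξS hΛξ hQ hAbh hdAh hAuh haE hg
    ιB hι (Rr i) (Hp i)
  have hsum := hasMajorant_add _ (hasMajorant_add _ (hasMajorant_add _ h4n h3w) h2) hD
  refine hasMajorant_mono _ hsum fun a a' => ?_
  -- ─── the kernel ───
  show Θ₄ * (((ℓ : ℝ) + 1) * ((toKT i).Mh : ℝ))⁻¹ * (geo9K i).len a * ((geo9K i).len a')⁻¹ * Real.exp (-(δ₄ * (geo9K i).dist a a')) +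
      Θ₃ * ((ℓ : ℝ) + 1) * Real.exp (-(κ₃ * ((toKT i).Mh : ℝ))) * (geo9K i).len a * ((geo9K i).len a')⁻¹ * Real.exp (-(ρ₃ / 2 * (geo9K i).dist a a')) + 0 +
      ΘE * Real.exp (-(δE * (toKT i).Mh)) * (geo9K i).len a * ((geo9K i).len a')⁻¹ * Real.exp (-(δE * (geo9K i).dist a a')) ≤
    K₀ * (((toKT i).Mh : ℝ))⁻¹ * (geo9K i).len a * ((geo9K i).len a')⁻¹ * Real.exp (-(δ₀ * (geo9K i).dist a a'))
  have hd0 : 0 ≤ (geo9K i).dist a a' := B9GeoLemma21KLevelV1.geo9K_dist_nonneg' i a a'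
  have hex : ∀ ⦃ρ : ℝ⦄, δ₀ ≤ ρ → Real.exp (-(ρ * (geo9K i).dist a a')) ≤ Real.exp (-(δ₀ * (geo9K i).dist a a')) :=
    fun ρ hρ => Real.exp_le_exp.mpr (by have h' := mul_le_mul_of_nonneg_right hρ hd0; linarith only [h'])
  have hW : 0 ≤ ((geo9K i).len a * ((geo9K i).len a')⁻¹) := mul_nonneg (B9GeoLemma21KLevelV1.geo9K_len_pos i a).le (inv_nonneg.2 (B9GeoLemma21KLevelV1.geo9K_len_pos i a').le)
  have hMhT : (0 : ℝ) < ((toKT i).Mh : ℝ) := by rw [hMhEq]; exact hMh0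
  have hMhTi : (0 : ℝ) ≤ (((toKT i).Mh : ℝ))⁻¹ := inv_nonneg.2 hMhT.le
  have hk4 : Θ₄ * (((ℓ : ℝ) + 1) * ((toKT i).Mh : ℝ))⁻¹ * (geo9K i).len a * ((geo9K i).len a')⁻¹ * Real.exp (-(δ₄ * (geo9K i).dist a a')) ≤ Θ₄ * ((((toKT i).Mh : ℝ))⁻¹ * (((geo9K i).len a * ((geo9K i).len a')⁻¹) * Real.exp (-(δ₀ * (geo9K i).dist a a')))) := by
    have hinv : (((ℓ : ℝ) + 1) * ((toKT i).Mh : ℝ))⁻¹ ≤ (((toKT i).Mh : ℝ))⁻¹ := inv_anti₀ hMhT (le_mul_of_one_le_left hMhT.le hL1)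
    calc Θ₄ * (((ℓ : ℝ) + 1) * ((toKT i).Mh : ℝ))⁻¹ * (geo9K i).len a * ((geo9K i).len a')⁻¹ * Real.exp (-(δ₄ * (geo9K i).dist a a'))
        = Θ₄ * ((((ℓ : ℝ) + 1) * ((toKT i).Mh : ℝ))⁻¹ * (((geo9K i).len a * ((geo9K i).len a')⁻¹) * Real.exp (-(δ₄ * (geo9K i).dist a a')))) := by ring
      _ ≤ Θ₄ * ((((toKT i).Mh : ℝ))⁻¹ * (((geo9K i).len a * ((geo9K i).len a')⁻¹) * Real.exp (-(δ₀ * (geo9K i).dist a a')))) :=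
          mul_le_mul_of_nonneg_left (mul_le_mul hinv (mul_le_mul_of_nonneg_left (hex hδ₀4) hW)
            (mul_nonneg hW (Real.exp_nonneg _)) hMhTi) hΘ₄
  have hk3 : Θ₃ * ((ℓ : ℝ) + 1) * Real.exp (-(κ₃ * ((toKT i).Mh : ℝ))) * (geo9K i).len a * ((geo9K i).len a')⁻¹ * Real.exp (-(ρ₃ / 2 * (geo9K i).dist a a')) ≤ Θ₃ * ((ℓ : ℝ) + 1) * κ₃⁻¹ * ((((toKT i).Mh : ℝ))⁻¹ * (((geo9K i).len a * ((geo9K i).len a')⁻¹) * Real.exp (-(δ₀ * (geo9K i).dist a a')))) := by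
    have he := exp_neg_mul_le_inv hκ₃ hMhT
    calc Θ₃ * ((ℓ : ℝ) + 1) * Real.exp (-(κ₃ * ((toKT i).Mh : ℝ))) * (geo9K i).len a * ((geo9K i).len a')⁻¹ * Real.exp (-(ρ₃ / 2 * (geo9K i).dist a a'))
        = Θ₃ * ((ℓ : ℝ) + 1) * (Real.exp (-(κ₃ * ((toKT i).Mh : ℝ))) * (((geo9K i).len a * ((geo9K i).len a')⁻¹) * Real.exp (-(ρ₃ / 2 * (geo9K i).dist a a')))) := by ring
      _ ≤ Θ₃ * ((ℓ : ℝ) + 1) * ((κ₃⁻¹ * (((toKT i).Mh : ℝ))⁻¹) * (((geo9K i).len a * ((geo9K i).len a')⁻¹) * Real.exp (-(δ₀ * (geo9K i).dist a a')))) :=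
          mul_le_mul_of_nonneg_left (mul_le_mul he (mul_le_mul_of_nonneg_left (hex hδ₀3) hW)
            (mul_nonneg hW (Real.exp_nonneg _)) (mul_nonneg (inv_nonneg.2 hκ₃.le) hMhTi)) (by positivity)
      _ = Θ₃ * ((ℓ : ℝ) + 1) * κ₃⁻¹ * ((((toKT i).Mh : ℝ))⁻¹ * (((geo9K i).len a * ((geo9K i).len a')⁻¹) * Real.exp (-(δ₀ * (geo9K i).dist a a')))) := by ring
  have hkE : ΘE * Real.exp (-(δE * (toKT i).Mh)) * (geo9K i).len a * ((geo9K i).len a')⁻¹ * Real.exp (-(δE * (geo9K i).dist a a')) ≤ ΘE * δE⁻¹ * ((((toKT i).Mh : ℝ))⁻¹ * (((geo9K i).len a * ((geo9K i).len a')⁻¹) * Real.exp (-(δ₀ * (geo9K i).dist a a')))) := by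
    have he := exp_neg_mul_le_inv hδE hMhT
    calc ΘE * Real.exp (-(δE * (toKT i).Mh)) * (geo9K i).len a * ((geo9K i).len a')⁻¹ * Real.exp (-(δE * (geo9K i).dist a a'))
        = ΘE * (Real.exp (-(δE * ((toKT i).Mh : ℝ))) * (((geo9K i).len a * ((geo9K i).len a')⁻¹) * Real.exp (-(δE * (geo9K i).dist a a')))) := by ring
      _ ≤ ΘE * ((δE⁻¹ * (((toKT i).Mh : ℝ))⁻¹) * (((geo9K i).len a * ((geo9K i).len a')⁻¹) * Real.exp (-(δ₀ * (geo9K i).dist a a')))) :=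
          mul_le_mul_of_nonneg_left (mul_le_mul he (mul_le_mul_of_nonneg_left (hex hδ₀E) hW)
            (mul_nonneg hW (Real.exp_nonneg _)) (mul_nonneg (inv_nonneg.2 hδE.le) hMhTi)) hΘE
      _ = ΘE * δE⁻¹ * ((((toKT i).Mh : ℝ))⁻¹ * (((geo9K i).len a * ((geo9K i).len a')⁻¹) * Real.exp (-(δ₀ * (geo9K i).dist a a')))) := by ring
  calc Θ₄ * (((ℓ : ℝ) + 1) * ((toKT i).Mh : ℝ))⁻¹ * (geo9K i).len a * ((geo9K i).len a')⁻¹ * Real.exp (-(δ₄ * (geo9K i).dist a a')) +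
        Θ₃ * ((ℓ : ℝ) + 1) * Real.exp (-(κ₃ * ((toKT i).Mh : ℝ))) * (geo9K i).len a * ((geo9K i).len a')⁻¹ * Real.exp (-(ρ₃ / 2 * (geo9K i).dist a a')) + 0 +
        ΘE * Real.exp (-(δE * (toKT i).Mh)) * (geo9K i).len a * ((geo9K i).len a')⁻¹ * Real.exp (-(δE * (geo9K i).dist a a'))
      ≤ Θ₄ * ((((toKT i).Mh : ℝ))⁻¹ * (((geo9K i).len a * ((geo9K i).len a')⁻¹) * Real.exp (-(δ₀ * (geo9K i).dist a a')))) + Θ₃ * ((ℓ : ℝ) + 1) * κ₃⁻¹ * ((((toKT i).Mh : ℝ))⁻¹ * (((geo9K i).len a * ((geo9K i).len a')⁻¹) * Real.exp (-(δ₀ * (geo9K i).dist a a')))) + 0 +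
        ΘE * δE⁻¹ * ((((toKT i).Mh : ℝ))⁻¹ * (((geo9K i).len a * ((geo9K i).len a')⁻¹) * Real.exp (-(δ₀ * (geo9K i).dist a a')))) := add_le_add (add_le_add (add_le_add hk4 hk3) le_rfl) hkE
    _ = K₀ * (((toKT i).Mh : ℝ))⁻¹ * (geo9K i).len a * ((geo9K i).len a')⁻¹ * Real.exp (-(δ₀ * (geo9K i).dist a a')) := by rw [hK₀def]; ring

end Literature.MathematicalPhysics.QuantumFieldTheory.Balaban1983to89.B9Eq3105RestTAtMember
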